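import Literature.AnabelianGeometry.SemiGraphs.TemperedThm37OfNoCore
import Literature.AnabelianGeometry.SemiGraphs.TemperedPiBranchStabilizerImage
import Literature.AnabelianGeometry.SemiGraphs.TemperedPiPointSeqThroughVertex
import Literature.AnabelianGeometry.SemiGraphs.TemperedPiVerticialLevelData
import Literature.AnabelianGeometry.SemiGraphs.TemperedMaximalCompact
import Literature.AnabelianGeometry.SemiGraphs.TreeSystemFixedPointTopological
import Literature.AnabelianGeometry.SemiGraphs.TemperedChartTransport
import HarnessLib

/-!
# [SemiAnbd] Thm 3.7 (iii), FIRST sentence for ANCHORED compact subgroups, at every countable graph WITHOUT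
# CORE whose EDGE GROUPS ARE ABELIAN — no local finiteness, no level-estrangement (proof-only)

Mochizuki, *Semi-graphs of anabelioids*, Publ. RIMS **42** (2006), §3, Theorem 3.7 (iii) pp. 40–41 ("any
compact subgroup of `π₁^temp(𝒢)` is contained in at least one verticial subgroup"), (iv) p. 41 ("the maximal
compact subgroups of `π₁^temp(𝒢)` are precisely the verticial subgroups"), Remark 2.2.1 p. 24 (stabilisers of
compatible systems of vertices / edges) [cite: MochizukiSemiAnbd2006, Thm 3.7(iii) pp.40-41].

PROOF-ONLY file (abc-iut cell, layer L3, row «ANCHORED@STAR» = tier 2 (b) of «COR39-R3c@RAYLESS-STAR», seat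
abc-iut-w6-d064 gen 7, L3-lead γ68 (3); no definition, no named fact, no custody file touched).  The EXISTENCE
sentence of Thm 3.7 (iii) in the cell's ∀-countable typing fails at abc-iut-L3-d1's ray `𝒢_θ` and at
abc-iut-L3-t8's rayless star `𝒢⋆(p)` for ANCHOR-FREE compact subgroups.  abc-iut-w6-d062 proved it for ANCHORED
compact subgroups (`K ⊓ H₀ ≠ 1` for some verticial `H₀`) at LOCALLY FINITE `𝔾`
(`TemperedAnchoredCompactOfLocallyFinite.lean`), through the strong local level-estrangement (LE) — which is FALSE
at a vertex of infinite valence such as the centre of `𝒢⋆(p)` (the edge groups `A_n = ⟨a b^{pⁿ}⟩‾` accumulate at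
`⟨a⟩‾`).  Here the anchored sentence is proved WITHOUT (LE) and WITHOUT local finiteness, for every countable `𝒢`
satisfying the hypotheses of Thm 3.7 whose underlying graph has NO infinitely-branching CORE (abc-iut-f-176's
clause `hNC`, `TemperedHbddOfNoCore.lean`) and whose EDGE GROUPS `Π_e` ARE COMMUTATIVE (procyclic `ℤ_p` /
`Ẑ(1)^{(Σ)}` in every curve-theoretic or model graph of the cell), at EVERY chart:

* `exists_verticial_ge_of_inf_verticial_ne_bot_of_noCore_of_commEdges` — **every compact `K ≤ π₁^temp(𝒢)`
  meeting some verticial subgroup `H₀` non-trivially lies in a verticial subgroup** (indeed in `H₀` or in the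
  stabiliser of a compatible `K`-fixed vertex system).

ARGUMENT (new; two cases on the `K`-fixed subtrees `F_j ⊆ 𝒢_{∞,j}`, which are non-empty by [SemiAnbd] Lemma
1.8 (ii), `SemiGraph.exists_fixed_vertex_of_isCompact_over`): (A) if `F_j` is a SINGLE vertex for cofinally many
`j`, these vertices are compatible (images of fixed vertices are fixed) and (I2) `stab` gives a verticial host;
(B) otherwise, from some level on `F_j` contains two vertices, hence a `K`-fixed BRANCH at a `K`-fixed vertex, so
by abc-iut-L3-t11's one-level branch-stabiliser dictionary (`TemperedPiBranchStabilizerImage.lean`, here with the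
conjugator chosen ONCE per branch: `PointSeq.exists_conj_forall_gal_brHom_of_branchMap_eq`) the level-`j`
components of all elements of `K` lie in ONE conjugate of the image of the COMMUTATIVE edge group — so they
commute; `π₁^temp = lim` separates points, hence `K` is COMMUTATIVE, so `K ≤ C(K ⊓ H₀) ≤ H₀` by abc-iut-f-176's
compact-centraliser theorem at graphs without core (`centralizer_le_verticial_of_noCore`).

Consequences (same hypotheses, every chart): `exists_mem_verticialSubgroups_of_isMaximalCompactSubgroup_of_noCore_of_commEdges`
(Thm 3.7 (iv), first clause, for ANCHORED maximal compact subgroups), `inf_verticial_eq_bot_of_forall_not_le_…`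
(violators of the existence sentence are ANCHOR-FREE), `le_verticial_or_anchorFree_…` (dichotomy),
`exists_anchorFree_of_not_compactInVerticialAt_…` (negative reading of `¬ CompactInVerticialAt 𝒢`).
The instance at `𝒢⋆(p)` is the companion file `MetabelianLeafStarAnchored.lean`.

Honest framing: OUR typed tempered fundamental groups; nothing is asserted for anchor-free compact subgroups
(where the sentence fails at `𝒢_θ`, `𝒢⋆(p)`); nothing here bears on [IUTchIII] Cor. 3.12; typed ≠ proved.
-/

namespace Literature.AnabelianGeometry.SemiGraphs

namespace ProfiniteSemiGraph

namespace GaloisLevelData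

open CategoryTheory Topology
open Literature.AlgebraicGeometry.Frobenioids.QuasiTemperoid.BTempConnected (ρ_one_apply
  ρ_mul_apply ρ_inv_apply)

universe u

variable {𝒢 : ProfiniteSemiGraph.{u}} {D : GaloisLevelData 𝒢} {h𝒢 : 𝒢.IsCountable}

/-! ### `π₁^temp = lim_n Gal(𝒢_{∞,n}/𝒢)` separates points (abc-iut-L3-t6's `pi_ext`), from a level on -/

/-- Two elements of `π₁^temp(𝒢) = lim_n Gal(𝒢_{∞,n}/𝒢)` with the same components from a level `j₁` on are
equal (the lower components are images of the higher ones; `pi_ext`). [cite: MochizukiSemiAnbd2006, Prop 3.6(i) p.38] -/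
theorem eq_of_forall_proj_eq_of_le {g g' : D.temperedPi h𝒢} (j₁ : ℕ)
    (h : ∀ n, j₁ ≤ n → D.proj h𝒢 n g = D.proj h𝒢 n g') : g = g' := by
  refine D.pi_ext h𝒢 fun n => ?_
  rw [← D.mapLE_proj h𝒢 (le_max_left n j₁) g, ← D.mapLE_proj h𝒢 (le_max_left n j₁) g',
    h (max n j₁) (le_max_right n j₁)]

namespace PointSeq

variable {w : 𝒢.graph.Vertex} (P : D.PointSeq h𝒢 w)

/-! ### Branch stabilisers with ONE conjugator per branch -/

/-- Cover-coordinate form of abc-iut-L3-t11's `exists_gal_conj_brHom_of_orbitGraphMap_branchMap_eq` with the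
conjugator chosen ONCE for the branch: for a branch `β₀` of the underlying semi-graph of `𝒢_{∞,n}` over the
branch `b` of `𝔾` (abutting to `w`) and abutting to the orbit of `P.pt n`, there is `f ∈ Π_w` such that EVERY
`σ ∈ Gal(𝒢_{∞,n}/𝒢)` fixing `β₀` is `σ_n^{f · b_*(k) · f⁻¹}` for some `k ∈ Π_e`.
[cite: MochizukiSemiAnbd2006, Rmk 2.2.1 p.24] -/
theorem exists_conj_forall_gal_brHom_of_orbitGraphMap_branchMap_eq (n : ℕ)
    (b : 𝒢.graph.Branch) (hb : 𝒢.graph.abuts b = some w)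
    (β₀ : (D.cover h𝒢 n).orbitGraph.Branch) (hβ₀b : β₀.1.1 = b)
    (hβ₀ : (D.cover h𝒢 n).orbitGraph.abuts β₀ = some (Quot.mk _ ⟨w, P.pt n⟩)) :
    ∃ f : 𝒢.Gv w, ∀ σ : D.Gal h𝒢 n, (CovObj.orbitGraphMap σ.hom).branchMap β₀ = β₀ →
      ∃ k : 𝒢.Ge (𝒢.graph.edgeOf b), σ = P.gal n (f * 𝒢.brHom b w hb k * f⁻¹) := by
  -- `β₀ = brOf b y` for a point `y ∈ (𝒢_{∞,n})_w`
  obtain ⟨y, rfl⟩ := (D.cover h𝒢 n).exists_eq_brOf b hb β₀ hβ₀b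
  -- `brOf b y` abuts to the orbit of `y`, hence `y = g · P.pt n`
  rw [(D.cover h𝒢 n).abuts_brOf b hb y] at hβ₀
  obtain ⟨g, hg⟩ := (D.cover h𝒢 n).exists_ρ_of_mk_eq_mk (Option.some.inj hβ₀).symm
  refine ⟨g⁻¹, fun σ hfix => ?_⟩
  -- `σ · brOf b y = brOf b (σ y)`, so `σ y = k · y` with `k ∈ Π_b`
  rw [(D.cover h𝒢 n).branchMap_brOf b hb σ y, (D.cover h𝒢 n).brOf_eq_brOf_iff b hb] at hfix
  obtain ⟨k', ⟨k, rfl⟩, hk⟩ := hfix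
  have hk' : (𝒢.brHom b w hb).toMonoidHom k = 𝒢.brHom b w hb k := rfl
  rw [hk'] at hk
  refine ⟨k, ?_⟩
  apply P.eq_gal
  have h1 : (σ.hom.fV w).hom.hom y = ((D.cover h𝒢 n).SV w).obj.ρ (𝒢.brHom b w hb k)⁻¹ y := by
    have h2 := congrArg (((D.cover h𝒢 n).SV w).obj.ρ (𝒢.brHom b w hb k)⁻¹) hk
    rw [← ρ_mul_apply, inv_mul_cancel, ρ_one_apply] at h2
    exact h2
  rw [← hg] at h1
  rw [CovHom.fV_ρ] at h1
  have h3 := congrArg (((D.cover h𝒢 n).SV w).obj.ρ g⁻¹) h1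
  rw [← ρ_mul_apply, inv_mul_cancel, ρ_one_apply, ← ρ_mul_apply, ← ρ_mul_apply] at h3
  rw [h3]
  have h4 : (g⁻¹ * 𝒢.brHom b w hb k * g⁻¹⁻¹)⁻¹ = g⁻¹ * (𝒢.brHom b w hb k)⁻¹ * g := by group
  rw [h4]

/-- **Branch stabilisers with one conjugator per branch** (tree coordinates; [SemiAnbd] Rmk 2.2.1 at one
level of a Galois tower): for a branch `β` of the tree `𝔾̃_n` abutting to `P.vertex n` and lying over the branch
`b` of `𝔾` (abutting to `w`), there is `f ∈ Π_w` such that the level-`n` component of EVERY `g ∈ π₁^temp(𝒢)`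
fixing `β` is `σ_n^{f · b_*(k) · f⁻¹}` for some `k ∈ Π_e` — all in ONE conjugate of the branch subgroup.
[cite: MochizukiSemiAnbd2006, Rmk 2.2.1 p.24] -/
theorem exists_conj_forall_gal_brHom_of_branchMap_eq (n : ℕ)
    (b : 𝒢.graph.Branch) (hb : 𝒢.graph.abuts b = some w)
    (β : (D.tree n).Branch) (hβb : (D.treeProj n).branchMap β = b)
    (hβ : (D.tree n).abuts β = some (P.vertex n)) :
    ∃ f : 𝒢.Gv w, ∀ g : D.temperedPi h𝒢, (D.treeAct h𝒢 n g).hom.branchMap β = β →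
      ∃ k : 𝒢.Ge (𝒢.graph.edgeOf b), D.proj h𝒢 n g = P.gal n (f * 𝒢.brHom b w hb k * f⁻¹) := by
  set β₀ := (D.treeIso h𝒢 n).inv.branchMap β with hβ₀
  have hβeq : β = (D.treeIso h𝒢 n).hom.branchMap β₀ := (D.treeIso_hom_branchMap_inv h𝒢 n β).symm
  obtain ⟨f, hf⟩ := P.exists_conj_forall_gal_brHom_of_orbitGraphMap_branchMap_eq n b hb β₀
    (by rw [← hβb, hβeq, D.treeProj_branchMap_treeIso h𝒢])
    (by
      apply D.orbitGraph_abuts_of_tree_abuts h𝒢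
      rw [← hβeq]
      exact hβ)
  refine ⟨f, fun g hfix => hf (D.proj h𝒢 n g) ?_⟩
  have h1 := hfix
  rw [D.treeAct_apply, hβeq, D.galTreeAct_branchMap_treeIso h𝒢] at h1
  have h2 := congrArg (D.treeIso h𝒢 n).inv.branchMap h1
  rw [D.treeIso_inv_branchMap_hom h𝒢, D.treeIso_inv_branchMap_hom h𝒢] at h2
  exact h2

/-- **Elements fixing a common branch have COMMUTING level components when the edge group is commutative**:
if `g₁, g₂ ∈ π₁^temp(𝒢)` both fix, at level `n`, a branch `β` of `𝔾̃_n` abutting to `P.vertex n` over a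
branch `b` whose edge group `Π_e` is commutative, then `ρ_n(g₁ g₂) = ρ_n(g₂ g₁)` (both components lie in
`σ_n^{f · b_*(Π_e) · f⁻¹}` for one `f`). [cite: MochizukiSemiAnbd2006, Rmk 2.2.1 p.24] -/
theorem proj_mul_comm_of_branchMap_eq (n : ℕ)
    (b : 𝒢.graph.Branch) (hb : 𝒢.graph.abuts b = some w)
    (hab : ∀ k k' : 𝒢.Ge (𝒢.graph.edgeOf b), k * k' = k' * k)
    (β : (D.tree n).Branch) (hβb : (D.treeProj n).branchMap β = b)
    (hβ : (D.tree n).abuts β = some (P.vertex n)) (g₁ g₂ : D.temperedPi h𝒢)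
    (h₁ : (D.treeAct h𝒢 n g₁).hom.branchMap β = β) (h₂ : (D.treeAct h𝒢 n g₂).hom.branchMap β = β) :
    D.proj h𝒢 n (g₁ * g₂) = D.proj h𝒢 n (g₂ * g₁) := by
  obtain ⟨f, hf⟩ := P.exists_conj_forall_gal_brHom_of_branchMap_eq n b hb β hβb hβ
  obtain ⟨k₁, hk₁⟩ := hf g₁ h₁
  obtain ⟨k₂, hk₂⟩ := hf g₂ h₂
  have e₁ : f * 𝒢.brHom b w hb k₁ * f⁻¹ * (f * 𝒢.brHom b w hb k₂ * f⁻¹) =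
      f * (𝒢.brHom b w hb k₁ * 𝒢.brHom b w hb k₂) * f⁻¹ := by group
  have e₂ : f * 𝒢.brHom b w hb k₂ * f⁻¹ * (f * 𝒢.brHom b w hb k₁ * f⁻¹) =
      f * (𝒢.brHom b w hb k₂ * 𝒢.brHom b w hb k₁) * f⁻¹ := by group
  rw [map_mul, map_mul, hk₁, hk₂, ← P.gal_mul, ← P.gal_mul, e₁, e₂, ← map_mul, ← map_mul, hab]

end PointSeq

end GaloisLevelData

/-! ### A fixed branch at a fixed vertex, from two fixed vertices -/

namespace VerticialLevelData

open CategoryTheory Topology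

universe v u

variable {𝒢 : ProfiniteSemiGraph.{u}} {c : TemperedPiChart 𝒢} (D : VerticialLevelData.{v} 𝒢 c)

/-- If a subgroup `K` fixes two DISTINCT vertices of the tree `𝒢_{∞,j}`, it fixes a branch abutting to the first
(the first step of the fixed geodesic). [cite: MochizukiSemiAnbd2006, Thm 3.7(iii) p.41] -/
theorem exists_fixed_branch_of_two_fixed_vertices (K : Subgroup c.G) (j : D.J) {z z' : (D.tree j).Vertex}
    (hne : z ≠ z') (hz : ∀ g ∈ K, (D.act j g).hom.vertexMap z = z)
    (hz' : ∀ g ∈ K, (D.act j g).hom.vertexMap z' = z') :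
    ∃ β : (D.tree j).Branch, (D.tree j).abuts β = some z ∧ ∀ g ∈ K, (D.act j g).hom.branchMap β = β := by
  classical
  have hT := (D.isTree j).isTree
  let p : (D.tree j).subdivision.Path (Sum.inl z) (Sum.inl z') :=
    (hT.connected (Sum.inl z) (Sum.inl z')).some.toPath
  have hfix : ∀ nd ∈ p.1.support, ∀ g ∈ K, SemiGraph.nodeMap (D.act j g) nd = nd := by
    intro nd hnd g hg
    have hxn : SemiGraph.nodeMap (D.act j g) (Sum.inl z) = Sum.inl z := by simp [hz g hg]
    have hzn : SemiGraph.nodeMap (D.act j g) (Sum.inl z') = Sum.inl z' := by simp [hz' g hg]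
    exact SemiGraph.nodeMap_eq_self_of_isPath hT.isAcyclic _ hxn hzn p.1 p.2 nd hnd
  -- the first step of the path is a branch at `z`
  obtain ⟨β, hβ, hβmem⟩ : ∃ β : (D.tree j).Branch, (D.tree j).abuts β = some z ∧
      (Sum.inr (Sum.inr β) : (D.tree j).Node) ∈ p.1.support := by
    have hne' : (Sum.inl z : (D.tree j).Node) ≠ Sum.inl z' := fun h => hne (Sum.inl_injective h)
    obtain ⟨q⟩ : Nonempty ((D.tree j).subdivision.Walk (Sum.inl z) (Sum.inl z')) := ⟨p.1⟩
    cases hp : p.1 with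
    | nil => exact (hne rfl).elim
    | cons h q' =>
      obtain ⟨β, hβ, hq⟩ := ((D.tree j).subdivision_adj_inl_iff z _).1 h
      subst hq
      exact ⟨β, hβ, by simp⟩
  refine ⟨β, hβ, fun g hg => ?_⟩
  have h := hfix _ hβmem g hg
  simp only [SemiGraph.nodeMap_inr_inr, Sum.inr.injEq] at h
  exact h

end VerticialLevelData

/-! ### The anchored existence theorem -/

open CategoryTheory Topology

universe u

variable (𝒢 : ProfiniteSemiGraph.{u})

/-- **ANCHORED Thm 3.7 (iii), first sentence, at the CANONICAL chart of a countable `𝒢` without core whose edge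
groups are commutative**: a compact `K ≤ π₁^temp(𝒢)` with `K ⊓ H₀ ≠ 1` for a verticial `H₀` lies in a verticial
subgroup.  Case (A): cofinally the `K`-fixed subtree of `𝒢_{∞,j}` is one vertex — compatible, (I2); case (B):
eventually it has a fixed branch at a fixed vertex — the level components of `K` commute
(`proj_mul_comm_of_branchMap_eq`), `K` is commutative, and `K ≤ C(K ⊓ H₀) ≤ H₀`
(`centralizer_le_verticial_of_noCore`). [cite: MochizukiSemiAnbd2006, Thm 3.7(iii) pp.40-41] -/
theorem exists_verticial_ge_of_inf_verticial_ne_bot_of_noCore_of_commEdges_canonical (h37 : 𝒢.Thm37Hypotheses)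
    (hNC : ∀ S : Set 𝒢.graph.Vertex, S.Nonempty → ∃ w ∈ S,
      {b : 𝒢.graph.Branch | 𝒢.graph.abuts b = some w ∧ ∃ b', b' ≠ b ∧ 𝒢.graph.edgeOf b' = 𝒢.graph.edgeOf b ∧
        ∃ w' ∈ S, 𝒢.graph.abuts b' = some w'}.Finite)
    (hab : ∀ (e : 𝒢.graph.Edge) (k k' : 𝒢.Ge e), k * k' = k' * k)
    (K : Subgroup (𝒢.temperedPiChart h37.toProp36Hypotheses).G)
    (hKc : IsCompact (K : Set (𝒢.temperedPiChart h37.toProp36Hypotheses).G))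
    {v₀ : 𝒢.graph.Vertex} {H₀ : Subgroup (𝒢.temperedPiChart h37.toProp36Hypotheses).G}
    (hH₀ : H₀ ∈ verticialSubgroups (𝒢.temperedPiChart h37.toProp36Hypotheses) v₀) (hanch : K ⊓ H₀ ≠ ⊥) :
    ∃ (v : 𝒢.graph.Vertex) (H : Subgroup (𝒢.temperedPiChart h37.toProp36Hypotheses).G),
      H ∈ verticialSubgroups (𝒢.temperedPiChart h37.toProp36Hypotheses) v ∧ K ≤ H := by
  classical
  let D₀ : VerticialLevelData.{0} 𝒢 (𝒢.temperedPiChart h37.toProp36Hypotheses) :=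
    verticialLevelData_temperedPiChart (h36 := h37.toProp36Hypotheses)
  -- [SemiAnbd] Lemma 1.8 (ii): the compact `K` fixes a vertex of every `𝒢_{∞,j}`
  have hfixK : ∀ j : D₀.J, ∃ z : (D₀.tree j).Vertex, ∀ g ∈ K, (D₀.act j g).hom.vertexMap z = z := by
    intro j
    obtain ⟨z, hz⟩ := SemiGraph.exists_fixed_vertex_of_isCompact_over K hKc (D₀.isTree j) (D₀.vertex j)
      (D₀.proj j) (D₀.act j) (D₀.isOpen_ker j) (D₀.act_over j)
    exact ⟨z, fun g hg => hz ⟨g, hg⟩⟩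
  by_cases hA : ∀ j₁ : D₀.J, ∃ j : D₀.J, j₁ ≤ j ∧ ∀ z z' : (D₀.tree j).Vertex,
      (∀ g ∈ K, (D₀.act j g).hom.vertexMap z = z) → (∀ g ∈ K, (D₀.act j g).hom.vertexMap z' = z') → z = z'
  · /- (A) cofinally ONE fixed vertex: the fixed vertices are compatible; (I2). -/
    choose φ hφle hφuniq using hA
    choose z hz using hfixK
    -- the fixed vertex at a uniqueness level is the image of the fixed vertex at any higher level
    have hzimg : ∀ (i : D₀.J) (m : D₀.J) (h : φ i ≤ m), (D₀.trans h).vertexMap (z m) = z (φ i) := by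
      intro i m h
      refine hφuniq i _ _ (fun g hg => ?_) (hz (φ i))
      rw [← D₀.trans_act_vertexMap h g (z m), hz m g hg]
    let y : ∀ i : D₀.J, (D₀.tree i).Vertex := fun i => (D₀.trans (hφle i)).vertexMap (z (φ i))
    have hy : ∀ ⦃i i' : D₀.J⦄ (h : i ≤ i'), (D₀.trans h).vertexMap (y i') = y i := by
      intro i i' h
      obtain ⟨M, hM, hM'⟩ := exists_ge_ge (φ i) (φ i')
      change (D₀.trans h).vertexMap ((D₀.trans (hφle i')).vertexMap (z (φ i'))) =
        (D₀.trans (hφle i)).vertexMap (z (φ i))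
      rw [← hzimg i M hM, ← hzimg i' M hM', D₀.trans_vertexMap_comp, D₀.trans_vertexMap_comp,
        D₀.trans_vertexMap_comp]
    have hfy : ∀ g ∈ K, ∀ i, (D₀.act i g).hom.vertexMap (y i) = y i := by
      intro g hg i
      change (D₀.act i g).hom.vertexMap ((D₀.trans (hφle i)).vertexMap (z (φ i))) =
        (D₀.trans (hφle i)).vertexMap (z (φ i))
      rw [← D₀.trans_act_vertexMap (hφle i) g, hz (φ i) g hg]
    obtain ⟨v, H, hH, hst⟩ := D₀.stab y hy
    exact ⟨v, H, hH, fun g hg => hst g fun i => hfy g hg i⟩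
  · /- (B) eventually TWO fixed vertices: a fixed branch at a fixed vertex at every large level; the level
    components of `K` commute; `K` is commutative; `K ≤ C(K ⊓ H₀) ≤ H₀`. -/
    push Not at hA
    obtain ⟨j₁, hj₁⟩ := hA
    have hcomm : ∀ g₁ ∈ K, ∀ g₂ ∈ K, g₁ * g₂ = g₂ * g₁ := by
      intro g₁ hg₁ g₂ hg₂
      refine GaloisLevelData.eq_of_forall_proj_eq_of_le (D := 𝒢.galoisLevelData h37.toProp36Hypotheses)
        (h𝒢 := h37.toProp36Hypotheses.isCountable) j₁ fun m hm => ?_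
      obtain ⟨z, z', hz, hz', hne⟩ := hj₁ m hm
      obtain ⟨β, hβz, hβfix⟩ := D₀.exists_fixed_branch_of_two_fixed_vertices K m hne hz hz'
      -- a compatible point sequence through `z`, over its base vertex
      obtain ⟨P, hP⟩ := exists_pointSeq_vertex_eq_galoisLevelData h37.toProp36Hypotheses m z
      have hb : 𝒢.graph.abuts (((𝒢.galoisLevelData h37.toProp36Hypotheses).treeProj m).branchMap β) =
          some (((𝒢.galoisLevelData h37.toProp36Hypotheses).treeProj m).vertexMap z) :=
        ((𝒢.galoisLevelData h37.toProp36Hypotheses).treeProj m).abuts_branchMap β z hβz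
      exact P.proj_mul_comm_of_branchMap_eq m _ hb (hab _) β rfl (hP.symm ▸ hβz) g₁ g₂
        (hβfix g₁ hg₁) (hβfix g₂ hg₂)
    -- `K ≤ C(K ⊓ H₀) ≤ H₀`
    haveI := (𝒢.temperedPiChart h37.toProp36Hypotheses).t2Space
    have hCc : IsCompact ((K ⊓ H₀ : Subgroup (𝒢.temperedPiChart h37.toProp36Hypotheses).G) :
        Set (𝒢.temperedPiChart h37.toProp36Hypotheses).G) := by
      rw [Subgroup.coe_inf]
      exact hKc.inter_right (isCompact_of_mem_verticialSubgroups _ hH₀).isClosed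
    refine ⟨v₀, H₀, hH₀, fun g hg => ?_⟩
    refine 𝒢.centralizer_le_verticial_of_noCore h37 hNC _ (K ⊓ H₀) hCc hanch hH₀ inf_le_right ?_
    rw [Subgroup.mem_centralizer_iff]
    rintro x ⟨hxK, -⟩
    exact hcomm x hxK g hg

variable {𝒢}

/-- **[SemiAnbd] Thm 3.7 (iii), first sentence, for ANCHORED compact subgroups at every countable `𝒢` WITHOUT
CORE whose EDGE GROUPS ARE COMMUTATIVE, every chart**: if `𝒢` satisfies the hypotheses of Thm 3.7, `𝔾` has no
infinitely-branching core, and every `Π_e` is commutative, then every compact `K ≤ π₁^temp(𝒢)` meeting some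
verticial subgroup `H₀` non-trivially (`K ⊓ H₀ ≠ 1`) is contained in a verticial subgroup.  No local finiteness,
no level-estrangement (contrast abc-iut-w6-d062's `exists_verticial_ge_of_inf_verticial_ne_bot_of_isLocallyFinite`);
the canonical-chart theorem transported along a compatible isomorphism of charts (`TemperedPiChart.exists_compatIso`).
[cite: MochizukiSemiAnbd2006, Thm 3.7(iii) pp.40-41] -/
theorem exists_verticial_ge_of_inf_verticial_ne_bot_of_noCore_of_commEdges (h37 : 𝒢.Thm37Hypotheses)
    (hNC : ∀ S : Set 𝒢.graph.Vertex, S.Nonempty → ∃ w ∈ S,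
      {b : 𝒢.graph.Branch | 𝒢.graph.abuts b = some w ∧ ∃ b', b' ≠ b ∧ 𝒢.graph.edgeOf b' = 𝒢.graph.edgeOf b ∧
        ∃ w' ∈ S, 𝒢.graph.abuts b' = some w'}.Finite)
    (hab : ∀ (e : 𝒢.graph.Edge) (k k' : 𝒢.Ge e), k * k' = k' * k)
    (c : TemperedPiChart 𝒢) (K : Subgroup c.G) (hKc : IsCompact (K : Set c.G))
    {v₀ : 𝒢.graph.Vertex} {H₀ : Subgroup c.G} (hH₀ : H₀ ∈ verticialSubgroups c v₀) (hanch : K ⊓ H₀ ≠ ⊥) :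
    ∃ (v : 𝒢.graph.Vertex) (H : Subgroup c.G), H ∈ verticialSubgroups c v ∧ K ≤ H := by
  obtain ⟨φ, ψ, hψφ, hφψ, hφ, hψ⟩ :=
    TemperedPiChart.exists_compatIso (𝒢.temperedPiChart h37.toProp36Hypotheses) c
  -- transport `K`, `H₀` to the canonical chart along `ψ`
  have hinj : Function.Injective ψ := fun y₁ y₂ h => by rw [← hφψ y₁, ← hφψ y₂, h]
  have hK' : IsCompact (K.map ψ.toMonoidHom : Set (𝒢.temperedPiChart h37.toProp36Hypotheses).G) := by
    rw [Subgroup.coe_map]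
    exact hKc.image ψ.continuous
  have hH₀' : H₀.map ψ.toMonoidHom ∈ verticialSubgroups (𝒢.temperedPiChart h37.toProp36Hypotheses) v₀ :=
    (mem_verticialSubgroups_iff_map φ hφ ψ hφψ hψ H₀).mp hH₀
  have hanch' : K.map ψ.toMonoidHom ⊓ H₀.map ψ.toMonoidHom ≠ ⊥ := by
    rw [← Subgroup.map_inf_eq K H₀ _ hinj]
    exact fun h0 => hanch ((Subgroup.map_eq_bot_iff_of_injective _ hinj).mp h0)
  obtain ⟨v, H', hH', hKH'⟩ :=
    𝒢.exists_verticial_ge_of_inf_verticial_ne_bot_of_noCore_of_commEdges_canonical h37 hNC hab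
      (K.map ψ.toMonoidHom) hK' hH₀' hanch'
  -- and back along `φ`
  refine ⟨v, H'.map φ.toMonoidHom, mem_verticialSubgroups_map φ hφ hH', fun g hg => ?_⟩
  exact ⟨ψ g, hKH' ⟨g, hg, rfl⟩, hφψ g⟩

/-- **The same with an explicit anchor**: a compact `K` containing a subgroup `A ≠ 1` that lies in a verticial
subgroup is contained in a verticial subgroup (no core, commutative edge groups, every chart).
[cite: MochizukiSemiAnbd2006, Thm 3.7(iii) pp.40-41] -/
theorem exists_verticial_ge_of_anchored_of_noCore_of_commEdges (h37 : 𝒢.Thm37Hypotheses)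
    (hNC : ∀ S : Set 𝒢.graph.Vertex, S.Nonempty → ∃ w ∈ S,
      {b : 𝒢.graph.Branch | 𝒢.graph.abuts b = some w ∧ ∃ b', b' ≠ b ∧ 𝒢.graph.edgeOf b' = 𝒢.graph.edgeOf b ∧
        ∃ w' ∈ S, 𝒢.graph.abuts b' = some w'}.Finite)
    (hab : ∀ (e : 𝒢.graph.Edge) (k k' : 𝒢.Ge e), k * k' = k' * k)
    (c : TemperedPiChart 𝒢) (K : Subgroup c.G) (hKc : IsCompact (K : Set c.G))
    {A : Subgroup c.G} (hA : A ≠ ⊥) (hAK : A ≤ K)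
    {v₀ : 𝒢.graph.Vertex} {H₀ : Subgroup c.G} (hH₀ : H₀ ∈ verticialSubgroups c v₀) (hAH₀ : A ≤ H₀) :
    ∃ (v : 𝒢.graph.Vertex) (H : Subgroup c.G), H ∈ verticialSubgroups c v ∧ K ≤ H :=
  exists_verticial_ge_of_inf_verticial_ne_bot_of_noCore_of_commEdges h37 hNC hab c K hKc hH₀
    fun h0 => hA (le_bot_iff.mp (h0 ▸ le_inf hAK hAH₀))

/-- **[SemiAnbd] Thm 3.7 (iv), first clause, for ANCHORED maximal compact subgroups** (no core, commutative edge
groups, hypotheses of Thm 3.7, every chart): a maximal compact subgroup meeting some verticial subgroup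
non-trivially IS a verticial subgroup (it lies in one, which is compact — `isCompact_of_mem_verticialSubgroups`).
[cite: MochizukiSemiAnbd2006, Thm 3.7(iv) p.41] -/
theorem exists_mem_verticialSubgroups_of_isMaximalCompactSubgroup_of_noCore_of_commEdges
    (h37 : 𝒢.Thm37Hypotheses)
    (hNC : ∀ S : Set 𝒢.graph.Vertex, S.Nonempty → ∃ w ∈ S,
      {b : 𝒢.graph.Branch | 𝒢.graph.abuts b = some w ∧ ∃ b', b' ≠ b ∧ 𝒢.graph.edgeOf b' = 𝒢.graph.edgeOf b ∧
        ∃ w' ∈ S, 𝒢.graph.abuts b' = some w'}.Finite)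
    (hab : ∀ (e : 𝒢.graph.Edge) (k k' : 𝒢.Ge e), k * k' = k' * k)
    (c : TemperedPiChart 𝒢) (K : Subgroup c.G) (hK : IsMaximalCompactSubgroup K)
    {v₀ : 𝒢.graph.Vertex} {H₀ : Subgroup c.G} (hH₀ : H₀ ∈ verticialSubgroups c v₀) (hanch : K ⊓ H₀ ≠ ⊥) :
    ∃ v : 𝒢.graph.Vertex, K ∈ verticialSubgroups c v := by
  obtain ⟨v, H, hH, hKH⟩ :=
    exists_verticial_ge_of_inf_verticial_ne_bot_of_noCore_of_commEdges h37 hNC hab c K hK.1 hH₀ hanch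
  exact ⟨v, (hK.2 H (isCompact_of_mem_verticialSubgroups c hH) hKH) ▸ hH⟩

/-- **The violators of the existence sentence are ANCHOR-FREE** (no core, commutative edge groups, hypotheses of
Thm 3.7, every chart): a compact subgroup contained in no verticial subgroup meets every verticial subgroup
trivially. [cite: MochizukiSemiAnbd2006, Thm 3.7(iii) pp.40-41] -/
theorem inf_verticial_eq_bot_of_forall_not_le_of_noCore_of_commEdges (h37 : 𝒢.Thm37Hypotheses)
    (hNC : ∀ S : Set 𝒢.graph.Vertex, S.Nonempty → ∃ w ∈ S,
      {b : 𝒢.graph.Branch | 𝒢.graph.abuts b = some w ∧ ∃ b', b' ≠ b ∧ 𝒢.graph.edgeOf b' = 𝒢.graph.edgeOf b ∧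
        ∃ w' ∈ S, 𝒢.graph.abuts b' = some w'}.Finite)
    (hab : ∀ (e : 𝒢.graph.Edge) (k k' : 𝒢.Ge e), k * k' = k' * k)
    (c : TemperedPiChart 𝒢) (K : Subgroup c.G) (hKc : IsCompact (K : Set c.G))
    (hno : ∀ (v : 𝒢.graph.Vertex) (H : Subgroup c.G), H ∈ verticialSubgroups c v → ¬ K ≤ H)
    {v₀ : 𝒢.graph.Vertex} {H₀ : Subgroup c.G} (hH₀ : H₀ ∈ verticialSubgroups c v₀) : K ⊓ H₀ = ⊥ := by
  by_contra hne
  obtain ⟨v, H, hH, hKH⟩ :=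
    exists_verticial_ge_of_inf_verticial_ne_bot_of_noCore_of_commEdges h37 hNC hab c K hKc hH₀ hne
  exact hno v H hH hKH

/-- **Dichotomy** (no core, commutative edge groups, hypotheses of Thm 3.7, every chart): a compact subgroup of
`π₁^temp(𝒢)` either lies in a verticial subgroup or is ANCHOR-FREE (meets every verticial subgroup trivially).
[cite: MochizukiSemiAnbd2006, Thm 3.7(iii) pp.40-41] -/
theorem le_verticial_or_anchorFree_of_noCore_of_commEdges (h37 : 𝒢.Thm37Hypotheses)
    (hNC : ∀ S : Set 𝒢.graph.Vertex, S.Nonempty → ∃ w ∈ S,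
      {b : 𝒢.graph.Branch | 𝒢.graph.abuts b = some w ∧ ∃ b', b' ≠ b ∧ 𝒢.graph.edgeOf b' = 𝒢.graph.edgeOf b ∧
        ∃ w' ∈ S, 𝒢.graph.abuts b' = some w'}.Finite)
    (hab : ∀ (e : 𝒢.graph.Edge) (k k' : 𝒢.Ge e), k * k' = k' * k)
    (c : TemperedPiChart 𝒢) (K : Subgroup c.G) (hKc : IsCompact (K : Set c.G)) :
    (∃ (v : 𝒢.graph.Vertex) (H : Subgroup c.G), H ∈ verticialSubgroups c v ∧ K ≤ H) ∨
      ∀ (v : 𝒢.graph.Vertex) (H : Subgroup c.G), H ∈ verticialSubgroups c v → K ⊓ H = ⊥ := by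
  by_cases h : ∃ (v : 𝒢.graph.Vertex) (H : Subgroup c.G), H ∈ verticialSubgroups c v ∧ K ≤ H
  · exact Or.inl h
  · push Not at h
    exact Or.inr fun v H hH =>
      inf_verticial_eq_bot_of_forall_not_le_of_noCore_of_commEdges h37 hNC hab c K hKc h hH

/-- **Negative reading of `¬ CompactInVerticialAt 𝒢`** at a countable `𝒢` without core with commutative edge
groups: if the per-graph Thm 3.7 (iii) fails at `𝒢`, then some chart carries a compact ANCHOR-FREE subgroup
(one meeting every verticial subgroup trivially) — the sentences 2–3 being theorems there
(`compactInVerticialAt_iff_exists_verticial_of_noCore`). [cite: MochizukiSemiAnbd2006, Thm 3.7(iii) pp.40-41] -/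
theorem exists_anchorFree_of_not_compactInVerticialAt_of_noCore_of_commEdges
    (hNC : ∀ S : Set 𝒢.graph.Vertex, S.Nonempty → ∃ w ∈ S,
      {b : 𝒢.graph.Branch | 𝒢.graph.abuts b = some w ∧ ∃ b', b' ≠ b ∧ 𝒢.graph.edgeOf b' = 𝒢.graph.edgeOf b ∧
        ∃ w' ∈ S, 𝒢.graph.abuts b' = some w'}.Finite)
    (hab : ∀ (e : 𝒢.graph.Edge) (k k' : 𝒢.Ge e), k * k' = k' * k)
    (hfail : ¬ CompactInVerticialAt 𝒢) :
    ∃ (_ : 𝒢.Thm37Hypotheses) (c : TemperedPiChart 𝒢) (K : Subgroup c.G), IsCompact (K : Set c.G) ∧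
      ∀ (v : 𝒢.graph.Vertex) (H : Subgroup c.G), H ∈ verticialSubgroups c v → K ⊓ H = ⊥ := by
  rw [𝒢.compactInVerticialAt_iff_exists_verticial_of_noCore hNC] at hfail
  push Not at hfail
  obtain ⟨h37, c, K, hKc, hno⟩ := hfail
  refine ⟨h37, c, K, hKc, fun v H hH => ?_⟩
  exact inf_verticial_eq_bot_of_forall_not_le_of_noCore_of_commEdges h37 hNC hab c K hKc
    (fun v' H' hH' hle => hno v' H' hH' hle) hH

end ProfiniteSemiGraph

end Literature.AnabelianGeometry.SemiGraphs
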